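import Mathlib
import Literature.Probability.Percolation.PercolationProofs
import Literature.Probability.LatticeModels.ProdBernoulliIndependence
import Literature.Probability.LatticeModels.ProdBernoulliClusterLocality
import Literature.Probability.LatticeModels.ProdBernoulliCoupling
import Literature.Probability.Percolation.KozmaNitzanPinning
import Summits.CriticalPhenomena.PercolationContinuityZ3.Theorems.PercNearOneGluingAdditiveGluingGoodBase
import Summits.CriticalPhenomena.PercolationContinuityZ3.Theorems.PercNearOneGluingAdditiveGluingLemma5AnyRelay
import HarnessLib

/-! # Crux `PercNearOneGluing.AdditiveGluing` (stmt-CriticalPhenomena-4576), line `subuniform-dead-pocket-maximum` — towards `stub_goodStep`, I: the star of the observer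

Helper file for the crux skeleton `Cruxes/AdditiveGluing/Lines/subuniform-dead-pocket-maximum.lean`
(siege on the HARDEST stub `stub_goodStep`, variation "explicit two-point closed form then bootstrap";
prover-siege-stmt-CriticalPhenomena-4576-stub_goodStep-32).  Lands with `--supports stmt-CriticalPhenomena-4576`.

## Content (deterministic and measure-theoretic groundwork for Kozma–Nitzan's `σ_B`-decomposition at
the observer `o`, arXiv:2401.12397 §3.2, proof of Theorem 5, pp. 13–14)

* §A. Configurations whose only open non-loop pair at `o` is `o–x`: open walks between vertices
  other than `o` never need `o` (`goodStep_openConn_iff_of_star_single`), `o ↔ v ⟺ x ↔ v in {o}ᶜ`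
  (`goodStep_openConn_observer_iff_of_star_single`), and `C(o) = insert o (C_{{o}ᶜ}(x))`
  (`goodStep_openCluster_of_star_single`).
* §A'. Configurations with the star of `o` closed: `C(x) = C_{{o}ᶜ}(x)`, connections avoid `o`,
  and avoiding `W ∖ {o}` is avoiding `W` (`goodStep_openConnIn_erase_of_isolated`).
* §B. Events determined by the pairs inside `{o}ᶜ` (complements, finite unions, avoidance events
  `{u ↔ v in Wᶜ}` for `o ∈ W`, the event "`o` + the `{o}ᶜ`-cluster of `x` is `W`"); KN's event `σ_B`
  ("the open star of `o` is exactly `o–B`") is the cylinder `[ξ_B]_F` over the star `F` of `o`, so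
  conditioning on it is PINNING (`goodStep_sigma_factor`:
  `μ_w(σ_B ∩ X) = μ_w(σ_B) · μ_{pinW w F ξ_B}(X)`, from `prodBernoulli_real_inter_localCylinder`);
  the pinned law has the star pattern a.s. (`goodStep_pin_ae_star`); the pinned and the star-deleted
  weightings (`w⁰ e = if o ∈ e then 0 else w e`) agree with `w` off the star.

No new definitions (the pinned weighting is the Literature `pinW`; `w⁰` is written as a lambda).
-/

namespace Summit.CriticalPhenomena.PercolationContinuityZ3.Theorems

open MeasureTheory Set
open Literature.Probability.LatticeModels (prodBernoulli)
open Literature.Probability.Percolation (BondConfig openConn openConnIn openGraph openCluster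
  openGraph_adj DeterminedBy determinedBy_iff PathIn pinW localCylinder)

noncomputable section
open Classical

variable {n : ℕ}

/-! ### A. Deterministic path lemmas: the star of `o` reduced to the single pair `o–x` -/

/-- On a configuration whose only open non-loop pair at `o` is `o–x`: an open walk from `u ≠ o`
reaches every `v ≠ o` inside `{o}ᶜ`, and if it reaches `o` then `u` reaches `x` inside `{o}ᶜ`.
[folklore] -/
theorem goodStep_pathIn_of_star_single {ω : BondConfig (Fin n)} {o x u : Fin n}
    (hω : ∀ y : Fin n, y ≠ o → (s(o, y) ∈ ω ↔ y = x)) (hu : u ≠ o) {v : Fin n}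
    (h : Relation.ReflTransGen (openGraph ω).Adj u v) :
    (v ≠ o → PathIn (openGraph ω) (({o} : Set (Fin n))ᶜ) u v) ∧
      (v = o → PathIn (openGraph ω) (({o} : Set (Fin n))ᶜ) u x) := by
  induction h with
  | refl => exact ⟨fun _ => PathIn.refl (Set.mem_compl_singleton_iff.2 hu), fun h => absurd h hu⟩
  | @tail c d _ hcd ih =>
    have hcd' := (openGraph_adj ω c d).1 hcd
    constructor
    · intro hd
      by_cases hc : c = o
      · -- `d` is an open neighbour of `o`, hence `d = x`
        subst hc
        have hdx : d = x := (hω d hd).1 hcd'.1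
        rw [hdx]
        exact ih.2 rfl
      · exact (ih.1 hc).tail hcd (Set.mem_compl_singleton_iff.2 hd)
    · intro hd
      subst hd
      -- `c` is an open neighbour of `o`, hence `c = x`
      have hco : c ≠ d := hcd'.2
      have hcx : c = x := (hω c hco).1 (by rw [Sym2.eq_swap]; exact hcd'.1)
      rw [← hcx]
      exact ih.1 hco

/-- Same hypothesis: for `u, v ≠ o`, `u ↔ v` iff `u ↔ v in {o}ᶜ`. [folklore] -/
theorem goodStep_openConn_iff_of_star_single {ω : BondConfig (Fin n)} {o x : Fin n}
    (hω : ∀ y : Fin n, y ≠ o → (s(o, y) ∈ ω ↔ y = x)) {u v : Fin n} (hu : u ≠ o) (hv : v ≠ o) :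
    ω ∈ openConn u v ↔ ω ∈ openConnIn (({o} : Set (Fin n))ᶜ) u v := by
  refine ⟨fun h => ?_, fun h => Literature.Probability.Percolation.openConnIn_subset_openConn _ u v h⟩
  have hr : (openGraph ω).Reachable u v := h
  rw [SimpleGraph.reachable_iff_reflTransGen] at hr
  exact Literature.Probability.Percolation.DCT16.mem_openConnIn_of_pathIn
    ((goodStep_pathIn_of_star_single hω hu hr).1 hv)

/-- Same hypothesis, `x ≠ o`: for `v ≠ o`, `o ↔ v` iff `x ↔ v in {o}ᶜ`. [folklore] -/
theorem goodStep_openConn_observer_iff_of_star_single {ω : BondConfig (Fin n)} {o x : Fin n}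
    (hω : ∀ y : Fin n, y ≠ o → (s(o, y) ∈ ω ↔ y = x)) (hx : x ≠ o) {v : Fin n} (hv : v ≠ o) :
    ω ∈ openConn o v ↔ ω ∈ openConnIn (({o} : Set (Fin n))ᶜ) x v := by
  have hadj : (openGraph ω).Adj o x := (openGraph_adj ω o x).2 ⟨(hω x hx).2 rfl, hx.symm⟩
  refine ⟨fun h => ?_, fun h => ?_⟩
  · have hr : (openGraph ω).Reachable o v := h
    rw [SimpleGraph.reachable_iff_reflTransGen] at hr
    rcases Relation.ReflTransGen.cases_head hr with hov | ⟨c, hoc, hcv⟩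
    · exact absurd hov.symm hv
    · have hoc' := (openGraph_adj ω o c).1 hoc
      have hcx : c = x := (hω c hoc'.2.symm).1 hoc'.1
      subst hcx
      exact Literature.Probability.Percolation.DCT16.mem_openConnIn_of_pathIn
        ((goodStep_pathIn_of_star_single hω hx hcv).1 hv)
  · exact hadj.reachable.trans
      (Literature.Probability.Percolation.openConnIn_subset_openConn _ x v h)

/-- Same hypothesis, `x ≠ o`: the open cluster of `o` is `o` together with the cluster of `x`
inside `{o}ᶜ`. [folklore] -/
theorem goodStep_openCluster_of_star_single {ω : BondConfig (Fin n)} {o x : Fin n}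
    (hω : ∀ y : Fin n, y ≠ o → (s(o, y) ∈ ω ↔ y = x)) (hx : x ≠ o) :
    openCluster ω o = insert o {y | ω ∈ openConnIn (({o} : Set (Fin n))ᶜ) x y} := by
  ext y
  rw [Set.mem_insert_iff, Set.mem_setOf_eq]
  by_cases hy : y = o
  · subst hy
    exact iff_of_true (Literature.Probability.Percolation.mem_openCluster_self ω y) (Or.inl rfl)
  · rw [← goodStep_openConn_observer_iff_of_star_single hω hx hy]
    exact ⟨fun h => Or.inr h, fun h => h.resolve_left hy⟩

/-! ### A'. Deterministic path lemmas: the star of `o` closed -/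

/-- If no non-loop pair at `o` is open, the open cluster of `x ≠ o` is its cluster inside `{o}ᶜ`.
[folklore] -/
theorem goodStep_openCluster_of_isolated {ω : BondConfig (Fin n)} {o x : Fin n}
    (hω : ∀ y : Fin n, y ≠ o → s(o, y) ∉ ω) (hx : x ≠ o) :
    openCluster ω x = {y | ω ∈ openConnIn (({o} : Set (Fin n))ᶜ) x y} := by
  ext y
  rw [Set.mem_setOf_eq]
  by_cases hy : y = o
  · subst hy
    refine iff_of_false (fun h => ?_) (fun h => ?_)
    · have hr : (openGraph ω).Reachable x y := h
      rw [SimpleGraph.reachable_iff_reflTransGen] at hr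
      rcases Relation.ReflTransGen.cases_tail hr with hxy | ⟨c, _, hcy⟩
      · exact hx hxy.symm
      · have h' := (openGraph_adj ω c y).1 hcy
        exact hω c h'.2 (by rw [Sym2.eq_swap]; exact h'.1)
    · obtain ⟨_, hyo, _⟩ := h
      exact hyo rfl
  · have h := goodBase_isolated_inter_openConn (n := n) o x y hx
    constructor
    · intro hxy
      have hmem : ω ∈ {ω : BondConfig (Fin n) | ∀ y : Fin n, y ≠ o → s(o, y) ∉ ω} ∩ openConn x y :=
        ⟨hω, hxy⟩
      rw [h] at hmem
      exact hmem.2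
    · intro hxy
      exact Literature.Probability.Percolation.openConnIn_subset_openConn _ x y hxy

/-- If no non-loop pair at `o` is open, an open path inside `(W.erase o)ᶜ` between vertices other
than `o` is an open path inside `Wᶜ` (`o ∈ W`). [folklore] -/
theorem goodStep_openConnIn_erase_of_isolated {ω : BondConfig (Fin n)} {o : Fin n}
    (hω : ∀ y : Fin n, y ≠ o → s(o, y) ∉ ω) (W : Finset (Fin n)) {u v : Fin n}
    (hu : u ≠ o) :
    ω ∈ openConnIn ((↑(W.erase o) : Set (Fin n))ᶜ) u v ↔ ω ∈ openConnIn ((↑W : Set (Fin n))ᶜ) u v := by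
  have hsub : ((↑W : Set (Fin n))ᶜ) ⊆ ((↑(W.erase o) : Set (Fin n))ᶜ) :=
    Set.compl_subset_compl.2 (Finset.coe_subset.2 (Finset.erase_subset o W))
  refine ⟨fun h => ?_, fun h => ?_⟩
  swap
  · obtain ⟨hu', hv', hr⟩ := h
    exact ⟨hsub hu', hsub hv', hr.map (SimpleGraph.induceHomOfLE (G := openGraph ω) hsub).toHom⟩
  obtain ⟨huW, hr⟩ := Literature.Probability.Percolation.DCT16.pathIn_of_mem_openConnIn h
  clear h
  apply Literature.Probability.Percolation.DCT16.mem_openConnIn_of_pathIn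
  have hmem : ∀ z : Fin n, z ≠ o → z ∈ ((↑(W.erase o) : Set (Fin n))ᶜ) → z ∈ ((↑W : Set (Fin n))ᶜ) := by
    intro z hz hzW hzW'
    exact hzW (Finset.mem_coe.2 (Finset.mem_erase.2 ⟨hz, Finset.mem_coe.1 hzW'⟩))
  refine ⟨hmem u hu huW, ?_⟩
  induction hr with
  | refl => exact Relation.ReflTransGen.refl
  | @tail c d _ hcd ih =>
    have hd : d ≠ o := by
      rintro rfl
      have h' := (openGraph_adj ω c d).1 hcd.1
      exact hω c h'.2 (by rw [Sym2.eq_swap]; exact h'.1)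
    exact ih.tail ⟨hcd.1, hmem d hd hcd.2⟩


/-- If no non-loop pair at `o` is open: for `u, v ≠ o`, `u ↔ v` iff `u ↔ v in {o}ᶜ`. [folklore] -/
theorem goodStep_openConn_iff_of_isolated {ω : BondConfig (Fin n)} {o u v : Fin n}
    (hω : ∀ y : Fin n, y ≠ o → s(o, y) ∉ ω) (hu : u ≠ o) :
    ω ∈ openConn u v ↔ ω ∈ openConnIn (({o} : Set (Fin n))ᶜ) u v := by
  have h : v ∈ openCluster ω u ↔ v ∈ {y | ω ∈ openConnIn (({o} : Set (Fin n))ᶜ) u y} := by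
    rw [goodStep_openCluster_of_isolated hω hu]
  rw [Set.mem_setOf_eq] at h
  exact h

/-! ### B. Events determined off the star of `o`, and the pinned weightings -/

/-- Complements preserve `DeterminedBy`. [folklore] -/
theorem goodStep_determinedBy_compl {ι : Type*} {E : Set (Set ι)} {K : Set ι}
    (h : DeterminedBy E K) : DeterminedBy Eᶜ K := by
  rw [determinedBy_iff] at h ⊢
  intro ω ω' hωω'
  rw [Set.mem_compl_iff, Set.mem_compl_iff, h ω ω' hωω']

/-- Finite unions preserve `DeterminedBy`. [folklore] -/
theorem goodStep_determinedBy_biUnion {ι α : Type*} (A : Finset α) {E : α → Set (Set ι)} {K : Set ι}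
    (h : ∀ a ∈ A, DeterminedBy (E a) K) : DeterminedBy (⋃ a ∈ A, E a) K := by
  rw [determinedBy_iff]
  intro ω ω' hωω'
  simp only [Set.mem_iUnion, exists_prop]
  refine exists_congr fun a => and_congr_right fun ha => ?_
  exact (determinedBy_iff _ _).1 (h a ha) ω ω' hωω'

/-- `{u ↔ v in Wᶜ}` is determined by the pairs inside `{o}ᶜ` when `o ∈ W`. [folklore] -/
theorem goodStep_determinedBy_openConnIn_compl (W : Finset (Fin n)) {o : Fin n} (hoW : o ∈ W)
    (u v : Fin n) :
    DeterminedBy (openConnIn ((↑W : Set (Fin n))ᶜ) u v) ((({o} : Set (Fin n))ᶜ).sym2) := by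
  refine Literature.Probability.Percolation.DCT16.determinedBy_openConnIn _ u v fun e he => ?_
  induction e with
  | h a b =>
    rw [Set.mk_mem_sym2_iff] at he ⊢
    simp only [Set.mem_compl_iff, Finset.mem_coe, Set.mem_singleton_iff] at he ⊢
    exact ⟨fun h => he.1 (h ▸ hoW), fun h => he.2 (h ▸ hoW)⟩

/-- The event "`o` together with the cluster of `x` inside `{o}ᶜ` is `W`" is determined by the
pairs inside `{o}ᶜ`. [folklore] -/
theorem goodStep_determinedBy_insertCluster (o x : Fin n) (W : Set (Fin n)) :
    DeterminedBy {ω : BondConfig (Fin n) |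
        insert o {y | ω ∈ openConnIn (({o} : Set (Fin n))ᶜ) x y} = W}
      ((({o} : Set (Fin n))ᶜ).sym2) := by
  rw [determinedBy_iff]
  intro ω ω' hωω'
  have h : ∀ y, ω ∈ openConnIn (({o} : Set (Fin n))ᶜ) x y ↔ ω' ∈ openConnIn (({o} : Set (Fin n))ᶜ) x y :=
    fun y => (determinedBy_iff _ _).1
      (Literature.Probability.Percolation.DCT16.determinedBy_openConnIn _ x y subset_rfl) ω ω' hωω'
  simp only [Set.mem_setOf_eq]
  rw [show {y | ω ∈ openConnIn (({o} : Set (Fin n))ᶜ) x y} =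
      {y | ω' ∈ openConnIn (({o} : Set (Fin n))ᶜ) x y} from Set.ext fun y => h y]

/-- KN's event `σ_B` ("the open star of `o` is exactly `o–B`") is the cylinder `[ξ]_F` over the
star `F` of `o` with pattern `ξ = {o–y | y ∈ B}`. [folklore] -/
theorem goodStep_sigma_eq_localCylinder {o : Fin n} {B : Finset (Fin n)}
    {F : Finset (Sym2 (Fin n))} (hF : ∀ e, e ∈ F ↔ o ∈ e ∧ ¬ e.IsDiag)
    {ξ : Set (Sym2 (Fin n))} (hξ : ∀ y : Fin n, s(o, y) ∈ ξ ↔ y ∈ B) :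
    {ω : BondConfig (Fin n) | ∀ y : Fin n, y ≠ o → (s(o, y) ∈ ω ↔ y ∈ B)} =
      localCylinder (↑F : Set (Sym2 (Fin n))) ξ := by
  ext ω
  constructor
  · intro hω e he
    obtain ⟨hoe, hde⟩ := (hF e).1 (Finset.mem_coe.1 he)
    obtain ⟨y, rfl⟩ := Sym2.mem_iff_exists.1 hoe
    rw [hξ]
    exact hω y fun h => hde (Sym2.mk_isDiag_iff.2 h.symm)
  · intro hω y hyo
    rw [← hξ y]
    exact hω _ (Finset.mem_coe.2 ((hF _).2 ⟨Sym2.mem_mk_left o y,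
      fun h => hyo (Sym2.mk_isDiag_iff.1 h).symm⟩))

/-- **Conditioning on `σ_B` is pinning**: `μ_w(σ_B ∩ X) = μ_w(σ_B) · μ_{pinW w F ξ}(X)`.
[cite: KozmaNitzan2024, §3.2 p. 13] -/
theorem goodStep_sigma_factor (w : Sym2 (Fin n) → unitInterval) {o : Fin n} {B : Finset (Fin n)}
    {F : Finset (Sym2 (Fin n))} (hF : ∀ e, e ∈ F ↔ o ∈ e ∧ ¬ e.IsDiag)
    {ξ : Set (Sym2 (Fin n))} (hξ : ∀ y : Fin n, s(o, y) ∈ ξ ↔ y ∈ B) (X : Set (BondConfig (Fin n))) :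
    (prodBernoulli w).real
        ({ω : BondConfig (Fin n) | ∀ y : Fin n, y ≠ o → (s(o, y) ∈ ω ↔ y ∈ B)} ∩ X) =
      (prodBernoulli w).real {ω : BondConfig (Fin n) | ∀ y : Fin n, y ≠ o → (s(o, y) ∈ ω ↔ y ∈ B)} *
        (prodBernoulli (pinW w ↑F ξ)).real X := by
  rw [goodStep_sigma_eq_localCylinder hF hξ, Set.inter_comm]
  exact Literature.Probability.Percolation.prodBernoulli_real_inter_localCylinder w F ξ
    MeasurableSet.of_discrete

/-- Under the pinned weighting the open star of `o` is almost surely exactly `o–B`.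
[folklore] -/
theorem goodStep_pin_ae_star (w : Sym2 (Fin n) → unitInterval) {o : Fin n} {B : Finset (Fin n)}
    {F : Finset (Sym2 (Fin n))} (hF : ∀ e, e ∈ F ↔ o ∈ e ∧ ¬ e.IsDiag)
    {ξ : Set (Sym2 (Fin n))} (hξ : ∀ y : Fin n, s(o, y) ∈ ξ ↔ y ∈ B) :
    ∀ᵐ ω ∂prodBernoulli (pinW w ↑F ξ), ∀ y : Fin n, y ≠ o → (s(o, y) ∈ ω ↔ y ∈ B) := by
  have hstar : ∀ y : Fin n, y ≠ o → s(o, y) ∈ (↑F : Set (Sym2 (Fin n))) := fun y hy =>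
    Finset.mem_coe.2 ((hF _).2 ⟨Sym2.mem_mk_left o y, fun h => hy (Sym2.mk_isDiag_iff.1 h).symm⟩)
  refine ae_all_iff.2 fun y => ?_
  by_cases hyo : y = o
  · exact Filter.Eventually.of_forall fun ω h => absurd hyo h
  by_cases hyB : y ∈ B
  · filter_upwards [Literature.Probability.Percolation.prodBernoulli_ae_mem_of_eq_one (pinW w ↑F ξ)
      (Literature.Probability.Percolation.pinW_apply_of_mem_of_mem w (hstar y hyo) ((hξ y).2 hyB))]
      with ω hω using fun _ => iff_of_true hω hyB
  · filter_upwards [Literature.Probability.LatticeModels.prodBernoulli_ae_notMem (pinW w ↑F ξ)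
      (Literature.Probability.Percolation.pinW_apply_of_mem_of_not_mem w (hstar y hyo)
        fun h => hyB ((hξ y).1 h))] with ω hω using fun _ => iff_of_false hω hyB

/-- Off the star of `o` the pinned weighting is `w`. [folklore] -/
theorem goodStep_pin_offstar (w : Sym2 (Fin n) → unitInterval) {o : Fin n}
    {F : Finset (Sym2 (Fin n))} (hF : ∀ e, e ∈ F ↔ o ∈ e ∧ ¬ e.IsDiag) (ξ : Set (Sym2 (Fin n))) :
    ∀ e ∈ ((({o} : Set (Fin n))ᶜ).sym2), pinW w (↑F : Set (Sym2 (Fin n))) ξ e = w e := by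
  intro e he
  refine Literature.Probability.Percolation.pinW_apply_of_not_mem w ξ fun heF => ?_
  have hoe := ((hF e).1 (Finset.mem_coe.1 heF)).1
  induction e with
  | h a b =>
    rw [Set.mk_mem_sym2_iff, Set.mem_compl_singleton_iff, Set.mem_compl_singleton_iff] at he
    rcases Sym2.mem_iff.1 hoe with h | h
    · exact he.1 h.symm
    · exact he.2 h.symm

/-- Off the star of `o` the star-deleted weighting `w⁰ e = if o ∈ e then 0 else w e` is `w`.
[folklore] -/
theorem goodStep_del_offstar (w : Sym2 (Fin n) → unitInterval) (o : Fin n) :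
    ∀ e ∈ ((({o} : Set (Fin n))ᶜ).sym2),
      w e = (fun e : Sym2 (Fin n) => if o ∈ e then (0 : unitInterval) else w e) e := by
  intro e he
  induction e with
  | h a b =>
    rw [Set.mk_mem_sym2_iff, Set.mem_compl_singleton_iff, Set.mem_compl_singleton_iff] at he
    have hne : ¬ o ∈ s(a, b) := fun h => by
      rcases Sym2.mem_iff.1 h with h' | h'
      · exact he.1 h'.symm
      · exact he.2 h'.symm
    simp only [if_neg hne]

/-- Under the star-deleted weighting the star of `o` is almost surely closed. [folklore] -/
theorem goodStep_del_ae_isolated (w : Sym2 (Fin n) → unitInterval) (o : Fin n) :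
    ∀ᵐ ω ∂prodBernoulli (fun e : Sym2 (Fin n) => if o ∈ e then (0 : unitInterval) else w e),
      ∀ y : Fin n, y ≠ o → s(o, y) ∉ ω := by
  refine ae_all_iff.2 fun y => ?_
  by_cases hy : y = o
  · exact Filter.Eventually.of_forall fun ω h => absurd hy h
  · filter_upwards [Literature.Probability.LatticeModels.prodBernoulli_ae_notMem
      (fun e : Sym2 (Fin n) => if o ∈ e then (0 : unitInterval) else w e)
      (i := s(o, y)) (by simp)] with ω hω using fun _ => hω

/-! ### Registered waypoint (siege k32) -/

/-- Registered sub-goal `stub_goodStepSigmaFactor_k32` of stmt-CriticalPhenomena-4576 (siege k32 on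
`stub_goodStep`): **conditioning on KN's event `σ_B` is pinning the star of `o`** —
`μ_w(σ_B ∩ X) = μ_w(σ_B) · μ_{pin_B}(X)` with `pin_B = pinW w (star o) (o–B)`.
[cite: KozmaNitzan2024, §3.2 p. 13] -/
theorem stub_goodStepSigmaFactor_k32 :
    ∀ (n : ℕ) (w : Sym2 (Fin n) → unitInterval) (o : Fin n) (B : Finset (Fin n))
      (X : Set (BondConfig (Fin n))),
      (prodBernoulli w).real
          ({ω : BondConfig (Fin n) | ∀ y : Fin n, y ≠ o → (s(o, y) ∈ ω ↔ y ∈ B)} ∩ X) =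
        (prodBernoulli w).real {ω : BondConfig (Fin n) | ∀ y : Fin n, y ≠ o → (s(o, y) ∈ ω ↔ y ∈ B)} *
          (prodBernoulli (pinW w ↑(Finset.univ.filter fun e : Sym2 (Fin n) => o ∈ e ∧ ¬ e.IsDiag)
            ((fun y : Fin n => s(o, y)) '' (↑B : Set (Fin n))))).real X := by
  intro n w o B X
  exact goodStep_sigma_factor w (F := Finset.univ.filter fun e : Sym2 (Fin n) => o ∈ e ∧ ¬ e.IsDiag)
    (fun e => by simp) (fun y => by
      rw [Function.Injective.mem_set_image fun y y' h => Sym2.congr_right.1 h, Finset.mem_coe]) X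

end

end Summit.CriticalPhenomena.PercolationContinuityZ3.Theorems
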